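import Literature.RepresentationTheory.FiniteGroups.GLnUnipotent
import Literature.RepresentationTheory.FiniteGroups.GLnCuspidalReduction
import Literature.RepresentationTheory.FiniteGroups.MonomialCharacters
import Mathlib.NumberTheory.LegendreSymbol.AddCharacter
import HarnessLib

/-!
# Kirillov's dimension recursion: a cuspidal representation of `GL_n(𝔽_q)` has dimension
# `(q-1)(q²-1)⋯(q^{n-1}-1) · dim (Whittaker vectors)`

Topic `Literature/RepresentationTheory/FiniteGroups`.  (S. I. Gelfand, *Representations of the
full linear group over a finite field*, Mat. Sb. 1970; Bernstein–Zelevinsky, *Russian Math. Surveys*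
31 (1976) §3 for the `p`-adic analogue; Bump, *Automorphic Forms and Representations*, §4.1 for
`n = 2`.)  For a representation `ρ` of `GL_n(F)` on `V` and `1 ≤ t ≤ n` let
`W_t = {w | ρ(u) w = θ_t(u) w for u ∈ N_t}` (`N_t = tailGroup t`, `θ_t = theta ψ₀ t`), so `W_n = V`
and `W_1` is the space of Whittaker vectors.  If `ρ` is irreducible and **cuspidal**
(`GLn.IsCuspidal`), then `dim W_{c+1} = (q^c - 1) dim W_c` for `1 ≤ c ≤ n - 1`: the column group
`V_c ≅ F^c` acts on `W_{c+1}`; its weight for the trivial character is killed by cuspidality (it is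
fixed by the unipotent radical `U_{(c,n-c)}`), the `q^c - 1` non-trivial weights are permuted
transitively by `GL_c = leviBlock c`, and the weight of `x ↦ ψ₀(x_{c-1})` is `W_c`.  Hence
`dim V = ∏_{c=1}^{n-1} (q^c - 1) · dim W_1` (`finrank_eq_prod_mul_finrank_whittaker`).

Everything here is a theorem (no new definitions).

## References

* S. I. Gelfand, Mat. Sb. 83 (1970); I. N. Bernstein, A. V. Zelevinsky, Russian Math. Surveys 31:3
  (1976), §3; D. Bump, *Automorphic Forms and Representations*, §4.1.
-/

noncomputable section

open scoped BigOperators Matrix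
open Module

namespace Literature.RepresentationTheory.FiniteGroups.GLn

variable {F : Type} [Field F] {n : ℕ}

/-! ### Matrix lemmas: products with identity rows/columns -/

/-- If row `i` of `g` is `e_iᵀ` then row `i` of `g M` is row `i` of `M`. [folklore] -/
theorem mul_apply_of_row_eq {g : GL (Fin n) F} {S : Set (Fin n)} (hg : g ∈ fixRows F n S) {i : Fin n}
    (hi : i ∈ S) (M : Matrix (Fin n) (Fin n) F) (j : Fin n) : (g.val * M) i j = M i j := by
  rw [Matrix.mul_apply]
  calc ∑ l, g.val i l * M l j = ∑ l, (1 : Matrix (Fin n) (Fin n) F) i l * M l j :=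
        Finset.sum_congr rfl fun l _ => by rw [hg i hi l]
    _ = M i j := by rw [← Matrix.mul_apply, Matrix.one_mul]

/-- If column `j` of `g` is `e_j` then column `j` of `M g` is column `j` of `M`. [folklore] -/
theorem mul_apply_of_col_eq {g : GL (Fin n) F} {S : Set (Fin n)} (hg : g ∈ fixCols F n S) {j : Fin n}
    (hj : j ∈ S) (M : Matrix (Fin n) (Fin n) F) (i : Fin n) : (M * g.val) i j = M i j := by
  rw [Matrix.mul_apply]
  calc ∑ l, M i l * g.val l j = ∑ l, M i l * (1 : Matrix (Fin n) (Fin n) F) l j :=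
        Finset.sum_congr rfl fun l _ => by rw [hg j hj l]
    _ = M i j := by rw [← Matrix.mul_apply, Matrix.mul_one]

/-- If column `j` of `M` is `e_j` then column `j` of `g M` is column `j` of `g`. [folklore] -/
theorem mul_apply_of_col_eq_right (g M : Matrix (Fin n) (Fin n) F) {j : Fin n}
    (hM : ∀ i, M i j = (1 : Matrix (Fin n) (Fin n) F) i j) (i : Fin n) : (g * M) i j = g i j := by
  rw [Matrix.mul_apply]
  calc ∑ l, g i l * M l j = ∑ l, g i l * (1 : Matrix (Fin n) (Fin n) F) l j :=
        Finset.sum_congr rfl fun l _ => by rw [hM l]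
    _ = g i j := by rw [← Matrix.mul_apply, Matrix.mul_one]

/-! ### The factorisation `N_c = V_c · N_{c+1}` -/

/-- The column-`c` part `a = colElem c (g_{·c})` of `g ∈ N_c` has the same column `c` as `g`. [folklore] -/
theorem colElem_col_apply {c : Fin n} {g : GL (Fin n) F} (hg : g ∈ unitUpper F n) (i : Fin n) :
    (colElem F n c (fun i => g.val i c)).val i c = g.val i c := by
  rw [colElem_apply]
  by_cases hic : i < c
  · rw [if_pos ⟨rfl, hic⟩, Matrix.one_apply_ne (ne_of_lt hic), zero_add]
  · rw [if_neg (fun h => hic h.2), add_zero]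
    rcases (not_lt.mp hic).lt_or_eq with h | h
    · rw [hg.1 _ _ h, Matrix.one_apply_ne (ne_of_gt h)]
    · rw [h, hg.2, Matrix.one_apply_eq]

/-- **`N_c = V_c N_{c+1}`**: for `g ∈ N_c` (columns `< c` trivial) and `a = colElem c (g_{·c})`,
`a⁻¹ g ∈ N_{c+1}`. [folklore] -/
theorem colElem_inv_mul_mem_tailGroup {c : Fin n} {g : GL (Fin n) F} (hg : g ∈ tailGroup F n c.val) :
    (colElem F n c (fun i => g.val i c))⁻¹ * g ∈ tailGroup F n (c.val + 1) := by
  set a := colElem F n c (fun i => g.val i c) with ha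
  have haU : a ∈ unitUpper F n := colGroup_le_unitUpper c (colElem_mem F n c _)
  refine ⟨(unitUpper F n).mul_mem ((unitUpper F n).inv_mem haU) hg.1, fun j hj i => ?_⟩
  rcases Nat.lt_succ_iff_lt_or_eq.mp hj with hj | hj
  · -- columns `< c`: both `a⁻¹` and `g` fix `e_j`
    have hgj : ∀ i, g.val i j = (1 : Matrix (Fin n) (Fin n) F) i j := fun i => hg.2 j hj i
    rw [Units.val_mul, mul_apply_of_col_eq_right _ _ hgj]
    have ha' : a⁻¹ ∈ colGroup F n c := (colGroup F n c).inv_mem (colElem_mem F n c _)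
    exact ha'.2 j (fun h => by rw [h] at hj; exact lt_irrefl _ hj) i
  · -- column `c`: `a⁻¹ g e_c = a⁻¹ a e_c = e_c`
    have hjc : j = c := Fin.ext hj
    subst hjc
    have hcol : ∀ l, g.val l j = a.val l j := fun l => (colElem_col_apply hg.1 l).symm
    rw [Units.val_mul, Matrix.mul_apply]
    calc ∑ l, (a⁻¹).val i l * g.val l j = ∑ l, (a⁻¹).val i l * a.val l j :=
          Finset.sum_congr rfl fun l _ => by rw [hcol l]
      _ = ((a⁻¹ * a : GL (Fin n) F)).val i j := by rw [Units.val_mul, Matrix.mul_apply]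
      _ = _ := by rw [inv_mul_cancel, Units.val_one]

/-- `θ_{c+1}` is trivial on the column group `V_c`. [folklore] -/
theorem theta_succ_of_mem_colGroup (ψ₀ : AddChar F ℂ) {c : Fin n} {a : GL (Fin n) F}
    (ha : a ∈ colGroup F n c) : theta ψ₀ (c.val + 1) a = 1 := by
  rw [theta]
  convert AddChar.map_zero_eq_one ψ₀
  refine Finset.sum_eq_zero fun i _ => ?_
  split_ifs with h
  · unfold superdiag
    split_ifs with h'
    · have hne : (⟨i.val + 1, h'⟩ : Fin n) ≠ c := fun e => by
        have := congrArg Fin.val e; simp at this; omega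
      rw [ha.2 _ hne i, Matrix.one_apply_ne]
      exact fun e => by have := congrArg Fin.val e; simp at this
    · rfl
  · rfl

/-- On `N_{c+1}` the characters `θ_c` and `θ_{c+1}` agree (the entry `(c-1, c)` vanishes). [folklore] -/
theorem theta_eq_theta_succ_of_mem_tailGroup (ψ₀ : AddChar F ℂ) {c : Fin n} {u : GL (Fin n) F}
    (hu : u ∈ tailGroup F n (c.val + 1)) : theta ψ₀ c.val u = theta ψ₀ (c.val + 1) u := by
  unfold theta superdiagSum
  congr 1
  refine Finset.sum_congr rfl fun i _ => ?_
  by_cases h1 : c.val + 1 ≤ i.val + 1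
  · rw [if_pos h1, if_pos (by omega)]
  · rw [if_neg h1]
    split_ifs with h2
    · -- `i + 1 = c`: the entry `u_{i,i+1}` lies in the trivial column `c`
      unfold superdiag
      split_ifs with h3
      · have hic : (⟨i.val + 1, h3⟩ : Fin n) = c := Fin.ext (by simp; omega)
        rw [hu.2 _ (by simp; omega) i, Matrix.one_apply_ne]
        exact fun e => by have := congrArg Fin.val e; simp at this
      · rfl
    · rfl

/-- On `V_c`, `θ_c(a) = ψ₀(a_{c-1,c})`, i.e. `θ_c = colChar ψ₀ c e_{c-1}` (for `1 ≤ c`). [folklore] -/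
theorem theta_of_mem_colGroup (ψ₀ : AddChar F ℂ) {c : Fin n} (hc : 1 ≤ c.val) {a : GL (Fin n) F}
    (ha : a ∈ colGroup F n c) :
    theta ψ₀ c.val a = colChar ψ₀ c (Pi.single (⟨c.val - 1, by omega⟩ : Fin n) (1 : F)) a := by
  unfold theta colChar superdiagSum
  congr 1
  set i₀ : Fin n := ⟨c.val - 1, by omega⟩ with hi₀
  have hi₀v : i₀.val = c.val - 1 := rfl
  rw [Finset.sum_eq_single i₀, Finset.sum_eq_single i₀]
  · have h1 : c.val ≤ i₀.val + 1 := by omega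
    have h2 : i₀ < c := by rw [Fin.lt_def]; omega
    rw [if_pos h1, if_pos h2, Pi.single_eq_same, one_mul]
    unfold superdiag
    have h3 : i₀.val + 1 < n := by omega
    rw [dif_pos h3, show (⟨i₀.val + 1, h3⟩ : Fin n) = c from Fin.ext (by show i₀.val + 1 = c.val; omega)]
  · intro i _ hi
    rw [Pi.single_eq_of_ne hi, zero_mul, ite_self]
  · simp
  · intro i _ hi
    split_ifs with h1
    · unfold superdiag
      split_ifs with h3
      · by_cases h4 : (⟨i.val + 1, h3⟩ : Fin n) = c
        · exfalso; apply hi; exact Fin.ext (by have := congrArg Fin.val h4; simp at this; omega)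
        · rw [ha.2 _ h4 i, Matrix.one_apply_ne]
          exact fun e => by have := congrArg Fin.val e; simp at this
      · rfl
    · rfl
  · simp

/-! ### `N_{c+1}` is normalised by `N_c` and by the Levi block `GL_c` -/

/-- `N_{c+1} ⊴ N_c`: `n'⁻¹ u n' ∈ N_{c+1}` for `n' ∈ N_c`, `u ∈ N_{c+1}`. [folklore] -/
theorem conj_mem_tailGroup_succ {c : Fin n} {n' u : GL (Fin n) F} (hn' : n' ∈ tailGroup F n c.val)
    (hu : u ∈ tailGroup F n (c.val + 1)) : n'⁻¹ * u * n' ∈ tailGroup F n (c.val + 1) := by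
  have hn'i : n'⁻¹ ∈ tailGroup F n c.val := (tailGroup F n c.val).inv_mem hn'
  refine ⟨(unitUpper F n).mul_mem ((unitUpper F n).mul_mem hn'i.1 hu.1) hn'.1, fun j hj i => ?_⟩
  rcases Nat.lt_succ_iff_lt_or_eq.mp hj with hj' | hj'
  · rw [Units.val_mul, mul_apply_of_col_eq hn'.2 hj', Units.val_mul, mul_apply_of_col_eq hu.2 hj]
    exact hn'i.2 j hj' i
  · have hjc : j = c := Fin.ext hj'
    subst hjc
    rw [Units.val_mul, Matrix.mul_apply]
    have key : ∀ l, (n'⁻¹ * u).val i l * n'.val l j = (n'⁻¹).val i l * n'.val l j := fun l => by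
      by_cases hl : j < l
      · rw [hn'.1.1 _ _ hl, mul_zero, mul_zero]
      · rw [Units.val_mul, mul_apply_of_col_eq hu.2 (show l.val < j.val + 1 by
          rw [Fin.lt_def] at hl; omega)]
    rw [Finset.sum_congr rfl fun l _ => key l, ← Matrix.mul_apply, ← Units.val_mul, inv_mul_cancel,
      Units.val_one]

/-- `θ_{c+1}` is invariant under conjugation by `N_c` (indeed by all of `U_n`). [folklore] -/
theorem theta_conj (ψ₀ : AddChar F ℂ) (t : ℕ) {g u : GL (Fin n) F} (hg : g ∈ unitUpper F n)
    (hu : u ∈ unitUpper F n) : theta ψ₀ t (g⁻¹ * u * g) = theta ψ₀ t u := by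
  have hgi : g⁻¹ ∈ unitUpper F n := (unitUpper F n).inv_mem hg
  rw [theta_mul ψ₀ t ((unitUpper F n).mul_mem hgi hu) hg, theta_mul ψ₀ t hgi hu, mul_comm (theta ψ₀ t g⁻¹),
    mul_assoc, theta_inv ψ₀ t hg, mul_one]

/-- Entries of `g u g⁻¹` for `g ∈ GL_c` (Levi block) and `u ∈ N_{c+1}`: rows `≥ c` are those of
`u`, columns `≤ c` are trivial. [folklore] -/
theorem leviBlock_conj_apply {c : Fin n} {g u : GL (Fin n) F} (hg : g ∈ leviBlock F n c.val)
    (hu : u ∈ tailGroup F n (c.val + 1)) (i j : Fin n) :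
    (g * u * g⁻¹).val i j =
      if c.val ≤ i.val then u.val i j
      else if j.val ≤ c.val then (1 : Matrix (Fin n) (Fin n) F) i j else (g * u).val i j := by
  have hgi : g⁻¹ ∈ leviBlock F n c.val := (leviBlock F n c.val).inv_mem hg
  -- Lemma B: columns `≤ c` of `g u` are those of `g`
  have hB : ∀ m : Fin n, m.val ≤ c.val → ∀ i, (g * u).val i m = g.val i m := fun m hm i => by
    rw [Units.val_mul]
    exact mul_apply_of_col_eq_right _ _ (fun l => hu.2 m (Nat.lt_succ_of_le hm) l) i
  split_ifs with hi hj
  · -- row `i ≥ c`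
    rw [Units.val_mul, Units.val_mul, Matrix.mul_assoc, mul_apply_of_row_eq hg.2 hi]
    by_cases hj : c.val ≤ j.val
    · exact mul_apply_of_col_eq hgi.1 hj _ _
    · -- `j < c ≤ i`: both sides vanish
      push Not at hj
      rw [Matrix.mul_apply, hu.1.1 _ _ (by rw [Fin.lt_def]; omega)]
      refine Finset.sum_eq_zero fun l _ => ?_
      rcases lt_trichotomy l i with h | h | h
      · rw [hu.1.1 _ _ h, zero_mul]
      · subst h
        rw [hgi.2 l hi j, Matrix.one_apply_ne (fun e => by subst e; omega), mul_zero]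
      · rw [hgi.2 l (by rw [Fin.lt_def] at h; exact le_trans hi h.le) j,
          Matrix.one_apply_ne (fun e => by subst e; rw [Fin.lt_def] at h; omega), mul_zero]
  · -- row `i < c`, column `j ≤ c`
    push Not at hi
    rw [Units.val_mul, Matrix.mul_apply]
    have key : ∀ m, (g * u).val i m * (g⁻¹).val m j = g.val i m * (g⁻¹).val m j := fun m => by
      by_cases hm : m.val ≤ c.val
      · rw [hB m hm]
      · push Not at hm
        rw [hgi.2 m hm.le j, Matrix.one_apply_ne (fun e => by subst e; omega), mul_zero, mul_zero]
    rw [Finset.sum_congr rfl fun m _ => key m, ← Matrix.mul_apply, ← Units.val_mul, mul_inv_cancel,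
      Units.val_one]
  · -- row `i < c`, column `j > c`
    push Not at hi hj
    rw [Units.val_mul]
    exact mul_apply_of_col_eq hgi.1 hj.le _ _

/-- **`GL_c` normalises `N_{c+1}` and fixes `θ_{c+1}`.** [folklore] -/
theorem leviBlock_conj_mem_tailGroup {c : Fin n} {g u : GL (Fin n) F} (hg : g ∈ leviBlock F n c.val)
    (hu : u ∈ tailGroup F n (c.val + 1)) : g * u * g⁻¹ ∈ tailGroup F n (c.val + 1) := by
  have h := leviBlock_conj_apply hg hu
  refine ⟨⟨fun i j hij => ?_, fun i => ?_⟩, fun j hj i => ?_⟩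
  · rw [h]
    split_ifs with hi hj
    · exact hu.1.1 _ _ hij
    · exact Matrix.one_apply_ne (ne_of_gt hij)
    · exfalso; rw [Fin.lt_def] at hij; omega
  · rw [h]
    split_ifs with hi hj
    · exact hu.1.2 i
    · exact Matrix.one_apply_eq i
    · exfalso; omega
  · rw [h]
    split_ifs with hi hj'
    · exact hu.2 j hj i
    · rfl
    · exact absurd (Nat.le_of_lt_succ hj) hj'

/-- `θ_{c+1}(g u g⁻¹) = θ_{c+1}(u)` for `g ∈ GL_c`, `u ∈ N_{c+1}`. [folklore] -/
theorem theta_leviBlock_conj (ψ₀ : AddChar F ℂ) {c : Fin n} {g u : GL (Fin n) F}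
    (hg : g ∈ leviBlock F n c.val) (hu : u ∈ tailGroup F n (c.val + 1)) :
    theta ψ₀ (c.val + 1) (g * u * g⁻¹) = theta ψ₀ (c.val + 1) u := by
  unfold theta superdiagSum
  congr 1
  refine Finset.sum_congr rfl fun i _ => ?_
  split_ifs with h1
  · unfold superdiag
    split_ifs with h2
    · rw [leviBlock_conj_apply hg hu, if_pos (by omega)]
    · rfl
  · rfl

/-- **Conjugating a column element by the Levi block**: `g (1 + X_x) g⁻¹ = 1 + X_{g x}` for `x`
supported on the rows `< c`. [folklore] -/
theorem leviBlock_conj_colElem {c : Fin n} {g : GL (Fin n) F} (hg : g ∈ leviBlock F n c.val)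
    (x : Fin n → F) (hx : ∀ i : Fin n, c.val ≤ i.val → x i = 0) :
    g * colElem F n c x * g⁻¹ = colElem F n c (g.val *ᵥ x) := by
  have hgi : g⁻¹ ∈ leviBlock F n c.val := (leviBlock F n c.val).inv_mem hg
  apply Units.ext
  rw [Units.val_mul, Units.val_mul, coe_colElem, coe_colElem, mul_add, mul_one, add_mul, ← Units.val_mul,
    mul_inv_cancel, Units.val_one]
  congr 1
  ext i j
  rw [Matrix.mul_apply, colMatrix_apply]
  -- `(g X)_{im} = [m = c] (g x)_i`
  have hgX : ∀ m, (g.val * colMatrix F n c x) i m = if m = c then (g.val *ᵥ x) i else 0 := fun m => by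
    rw [Matrix.mul_apply, Matrix.mulVec, dotProduct]
    split_ifs with hm
    · subst hm
      refine Finset.sum_congr rfl fun l _ => ?_
      rw [colMatrix_apply]
      by_cases hl : l < m
      · rw [if_pos ⟨rfl, hl⟩]
      · rw [if_neg (fun h => hl h.2), hx l (by rw [Fin.lt_def] at hl; omega), mul_zero]
    · refine Finset.sum_eq_zero fun l _ => ?_
      rw [colMatrix_apply, if_neg (fun h => hm h.1), mul_zero]
  simp only [hgX, ite_mul, zero_mul, Finset.sum_ite_eq', Finset.mem_univ, if_true]
  -- row `c` of `g⁻¹` is `e_c`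
  rw [hgi.2 c (show c.val ≤ c.val from le_rfl) j]
  by_cases hjc : j = c
  · subst hjc
    rw [Matrix.one_apply_eq, mul_one]
    by_cases hic : i < j
    · rw [if_pos ⟨rfl, hic⟩]
    · rw [if_neg (fun h => hic h.2)]
      -- `(g x)_i = x_i = 0` for `i ≥ c`
      rw [Matrix.mulVec, dotProduct]
      refine Finset.sum_eq_zero fun l _ => ?_
      by_cases hl : j.val ≤ l.val
      · rw [hx l hl, mul_zero]
      · rw [hg.2 i (show j.val ≤ i.val by rw [Fin.lt_def] at hic; omega) l,
          Matrix.one_apply_ne (fun e => by subst e; omega), zero_mul]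
  · rw [Matrix.one_apply_ne (Ne.symm hjc), mul_zero, if_neg (fun h => hjc h.1)]

/-! ### Transitivity of `GL_c` on the non-zero characters of `V_c` -/

/-- A square-zero perturbation of the identity is invertible: `(1 + Z)(1 - Z) = 1`. [folklore] -/
theorem one_add_mul_one_sub_of_sq_zero {Z : Matrix (Fin n) (Fin n) F} (hZ : Z * Z = 0) :
    (1 + Z) * (1 - Z) = 1 := by
  rw [add_mul, mul_sub, mul_sub, one_mul, mul_one, one_mul, hZ, sub_zero, sub_add_cancel]

/-- `(1 - Z)(1 + Z) = 1` for `Z² = 0`. [folklore] -/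
theorem one_sub_mul_one_add_of_sq_zero {Z : Matrix (Fin n) (Fin n) F} (hZ : Z * Z = 0) :
    (1 - Z) * (1 + Z) = 1 := by
  rw [sub_mul, mul_add, mul_add, one_mul, mul_one, one_mul, hZ, add_zero, add_sub_cancel_right]

/-- **Transitivity, step 1**: if `y` is supported on the rows `< c` and `y_{c-1} ≠ 0`, there is
`g ∈ GL_c` with `yᵀ g = e_{c-1}ᵀ`. (`g = D (1 - Z)`, `D` scaling the coordinate `c-1` by `y_{c-1}⁻¹`
and `Z = ∑_{j ≠ c-1} y''_j E_{c-1,j}`.) [folklore] -/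
theorem exists_leviBlock_vecMul_eq_single_of_ne_zero {c : Fin n} (hc : 1 ≤ c.val) (y : Fin n → F)
    (hy : ∀ i : Fin n, c.val ≤ i.val → y i = 0) (hy0 : y ⟨c.val - 1, by omega⟩ ≠ 0) :
    ∃ g ∈ leviBlock F n c.val, y ᵥ* g.val = Pi.single (⟨c.val - 1, by omega⟩ : Fin n) (1 : F) := by
  set i₀ : Fin n := ⟨c.val - 1, by omega⟩ with hi₀
  have hi₀v : i₀.val = c.val - 1 := rfl
  have hi₀c : i₀.val < c.val := by omega
  -- the diagonal scaling
  let d : Fin n → F := fun j => if j = i₀ then (y i₀)⁻¹ else 1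
  have hd : ∀ j, d j ≠ 0 := fun j => by
    simp only [d]; split_ifs
    · exact inv_ne_zero hy0
    · exact one_ne_zero
  let D : GL (Fin n) F :=
    ⟨Matrix.diagonal d, Matrix.diagonal fun j => (d j)⁻¹,
      by rw [Matrix.diagonal_mul_diagonal, ← Matrix.diagonal_one]; congr 1; funext j; exact mul_inv_cancel₀ (hd j),
      by rw [Matrix.diagonal_mul_diagonal, ← Matrix.diagonal_one]; congr 1; funext j; exact inv_mul_cancel₀ (hd j)⟩
  set y'' : Fin n → F := y ᵥ* D.val with hy''
  have hy''apply : ∀ j, y'' j = y j * d j := fun j => by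
    rw [hy'', show D.val = Matrix.diagonal d from rfl, Matrix.vecMul_diagonal]
  have hy''i₀ : y'' i₀ = 1 := by rw [hy''apply]; simp only [d, if_pos rfl]; exact mul_inv_cancel₀ hy0
  have hy''c : ∀ j : Fin n, c.val ≤ j.val → y'' j = 0 := fun j hj => by rw [hy''apply, hy j hj, zero_mul]
  -- the row perturbation
  let Z : Matrix (Fin n) (Fin n) F := Matrix.of fun a b => if a = i₀ ∧ b ≠ i₀ then y'' b else 0
  have hZ : Z * Z = 0 := by
    ext a b
    rw [Matrix.mul_apply, Matrix.zero_apply]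
    refine Finset.sum_eq_zero fun l _ => ?_
    simp only [Z, Matrix.of_apply]
    by_cases h1 : a = i₀ ∧ l ≠ i₀
    · rw [if_neg (show ¬(l = i₀ ∧ b ≠ i₀) from fun h2 => h1.2 h2.1), mul_zero]
    · rw [if_neg h1, zero_mul]
  let R : GL (Fin n) F := ⟨1 - Z, 1 + Z, one_sub_mul_one_add_of_sq_zero hZ, one_add_mul_one_sub_of_sq_zero hZ⟩
  refine ⟨D * R, (leviBlock F n c.val).mul_mem ?_ ?_, ?_⟩
  · -- `D ∈ GL_c`
    refine ⟨fun j hj i => ?_, fun i hi j => ?_⟩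
    · simp only [Set.mem_setOf_eq] at hj
      show Matrix.diagonal d i j = _
      rw [Matrix.diagonal_apply, Matrix.one_apply]
      split_ifs with h
      · subst h; simp only [d]; rw [if_neg]; intro e; rw [e] at hj; omega
      · rfl
    · simp only [Set.mem_setOf_eq] at hi
      show Matrix.diagonal d i j = _
      rw [Matrix.diagonal_apply, Matrix.one_apply]
      split_ifs with h
      · subst h; simp only [d]; rw [if_neg]; intro e; rw [e] at hi; omega
      · rfl
  · -- `R ∈ GL_c`
    refine ⟨fun j hj i => ?_, fun i hi j => ?_⟩
    · simp only [Set.mem_setOf_eq] at hj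
      show (1 - Z) i j = _
      rw [Matrix.sub_apply]
      simp only [Z, Matrix.of_apply]
      split_ifs
      · rw [hy''c j hj, sub_zero]
      · rw [sub_zero]
    · simp only [Set.mem_setOf_eq] at hi
      show (1 - Z) i j = _
      rw [Matrix.sub_apply]
      simp only [Z, Matrix.of_apply]
      rw [if_neg, sub_zero]
      rintro ⟨h, -⟩; rw [h] at hi; omega
  · -- `y (D R) = y'' (1 - Z) = e_{i₀}`
    rw [Units.val_mul, ← Matrix.vecMul_vecMul, ← hy'']
    show y'' ᵥ* (1 - Z) = _
    rw [Matrix.vecMul_sub, Matrix.vecMul_one]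
    funext j
    rw [Pi.sub_apply, Matrix.vecMul, dotProduct, Finset.sum_eq_single i₀]
    · simp only [Z, Matrix.of_apply, hy''i₀, one_mul, true_and]
      by_cases hj : j = i₀
      · subst hj; rw [if_neg (fun h => h rfl), sub_zero, Pi.single_eq_same, hy''i₀]
      · rw [if_pos hj, sub_self, Pi.single_eq_of_ne hj]
    · intro a _ ha
      simp only [Z, Matrix.of_apply, if_neg (fun h : a = i₀ ∧ j ≠ i₀ => ha h.1), mul_zero]
    · simp

/-- **Transitivity**: for every non-zero `y` supported on the rows `< c` there is `g ∈ GL_c` with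
`yᵀ g = e_{c-1}ᵀ` (if `y_{c-1} = 0`, first apply the transvection `1 + E_{k,c-1}` with `y_k ≠ 0`).
[folklore] -/
theorem exists_leviBlock_vecMul_eq_single {c : Fin n} (hc : 1 ≤ c.val) (y : Fin n → F)
    (hy : ∀ i : Fin n, c.val ≤ i.val → y i = 0) (hy0 : y ≠ 0) :
    ∃ g ∈ leviBlock F n c.val, y ᵥ* g.val = Pi.single (⟨c.val - 1, by omega⟩ : Fin n) (1 : F) := by
  set i₀ : Fin n := ⟨c.val - 1, by omega⟩ with hi₀
  have hi₀v : i₀.val = c.val - 1 := rfl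
  by_cases h0 : y i₀ ≠ 0
  · exact exists_leviBlock_vecMul_eq_single_of_ne_zero hc y hy h0
  · push Not at h0
    obtain ⟨k, hk⟩ : ∃ k, y k ≠ 0 := by
      by_contra h; push Not at h; exact hy0 (funext h)
    have hkc : k.val < c.val := by
      by_contra h; push Not at h; exact hk (hy k h)
    have hki : k ≠ i₀ := fun e => by rw [e] at hk; exact hk h0
    -- the transvection `T = 1 + E_{k,i₀}`
    let E : Matrix (Fin n) (Fin n) F := Matrix.of fun a b => if a = k ∧ b = i₀ then 1 else 0
    have hE : E * E = 0 := by
      ext a b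
      rw [Matrix.mul_apply, Matrix.zero_apply]
      refine Finset.sum_eq_zero fun l _ => ?_
      simp only [E, Matrix.of_apply]
      by_cases h1 : a = k ∧ l = i₀
      · rw [if_neg (show ¬(l = k ∧ b = i₀) from fun h2 => hki (h2.1.symm.trans h1.2)), mul_zero]
      · rw [if_neg h1, zero_mul]
    let T : GL (Fin n) F := ⟨1 + E, 1 - E, one_add_mul_one_sub_of_sq_zero hE, one_sub_mul_one_add_of_sq_zero hE⟩
    have hT : T ∈ leviBlock F n c.val := by
      refine ⟨fun j hj i => ?_, fun i hi j => ?_⟩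
      · simp only [Set.mem_setOf_eq] at hj
        show (1 + E) i j = _
        rw [Matrix.add_apply]; simp only [E, Matrix.of_apply]
        rw [if_neg, add_zero]
        rintro ⟨-, h⟩; rw [h] at hj; omega
      · simp only [Set.mem_setOf_eq] at hi
        show (1 + E) i j = _
        rw [Matrix.add_apply]; simp only [E, Matrix.of_apply]
        rw [if_neg, add_zero]
        rintro ⟨h, -⟩; rw [h] at hi; omega
    -- `y' = y T` has `y'_{i₀} = y_k ≠ 0`
    set y' := y ᵥ* T.val with hy'
    have hy'apply : ∀ j, y' j = y j + if j = i₀ then y k else 0 := fun j => by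
      rw [hy', show T.val = 1 + E from rfl, Matrix.vecMul_add, Matrix.vecMul_one, Pi.add_apply,
        Matrix.vecMul, dotProduct, Finset.sum_eq_single k]
      · simp only [E, Matrix.of_apply, true_and]
        split_ifs <;> simp
      · intro a _ ha
        simp only [E, Matrix.of_apply, if_neg (fun h : a = k ∧ j = i₀ => ha h.1), mul_zero]
      · simp
    have hy'c : ∀ i : Fin n, c.val ≤ i.val → y' i = 0 := fun i hi => by
      rw [hy'apply, hy i hi, if_neg (fun e => by rw [e] at hi; omega), add_zero]
    have hy'0 : y' i₀ ≠ 0 := by rw [hy'apply, if_pos rfl, h0, zero_add]; exact hk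
    obtain ⟨g, hg, hyg⟩ := exists_leviBlock_vecMul_eq_single_of_ne_zero hc y' hy'c hy'0
    refine ⟨T * g, (leviBlock F n c.val).mul_mem hT hg, ?_⟩
    rw [Units.val_mul, ← Matrix.vecMul_vecMul, ← hy', hyg]

/-- From `yᵀ g = e_{c-1}ᵀ`: conjugation by `g` carries the character `θ_{e_{c-1}}` of `V_c` to `θ_y`:
`θ_{e_{c-1}}(g⁻¹ a g) = θ_y(a)` for `a ∈ V_c`. [folklore] -/
theorem colChar_conj_eq_of_vecMul_eq_single (ψ₀ : AddChar F ℂ) {c : Fin n} (hc : 1 ≤ c.val)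
    {y : Fin n → F} {g : GL (Fin n) F} (hg : g ∈ leviBlock F n c.val)
    (hyg : y ᵥ* g.val = Pi.single (⟨c.val - 1, by omega⟩ : Fin n) (1 : F)) {a : GL (Fin n) F}
    (ha : a ∈ colGroup F n c) :
    colChar ψ₀ c (Pi.single (⟨c.val - 1, by omega⟩ : Fin n) (1 : F)) (g⁻¹ * a * g) = colChar ψ₀ c y a := by
  set i₀ : Fin n := ⟨c.val - 1, by omega⟩ with hi₀
  have hi₀v : i₀.val = c.val - 1 := rfl
  have hi₀c : i₀ < c := by rw [Fin.lt_def]; omega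
  have hgi : g⁻¹ ∈ leviBlock F n c.val := (leviBlock F n c.val).inv_mem hg
  -- truncate the column of `a`
  set x : Fin n → F := fun i => if i < c then a.val i c else 0 with hx
  have hax : a = colElem F n c x := by
    rw [eq_colElem_of_mem F n ha]
    apply Units.ext; ext i j
    simp only [coe_colElem, Matrix.add_apply, colMatrix_apply, hx]
    split_ifs with h1 h2
    · rfl
    · exact absurd h1.2 h2
    · rfl
  have hxc : ∀ i : Fin n, c.val ≤ i.val → x i = 0 := fun i hi => by
    rw [hx]; dsimp only; rw [if_neg]; rw [Fin.lt_def]; omega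
  -- `g⁻¹ a g = colElem (g⁻¹ x)`
  have hconj : g⁻¹ * a * g = colElem F n c ((g⁻¹).val *ᵥ x) := by
    have := leviBlock_conj_colElem hgi x hxc
    rwa [inv_inv, ← hax] at this
  -- row `i₀` of `g⁻¹` is `y`
  have hrow : ∀ l, (g⁻¹).val i₀ l = y l := fun l => by
    have h1 : y ᵥ* g.val ᵥ* (g⁻¹).val = y := by
      rw [Matrix.vecMul_vecMul, ← Units.val_mul, mul_inv_cancel, Units.val_one, Matrix.vecMul_one]
    rw [hyg, Matrix.single_one_vecMul] at h1
    exact (congrFun h1 l)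
  rw [hconj, colChar_colElem, hax, colChar_colElem]
  congr 1
  -- both sums equal `∑_l y_l x_l`
  have lhs : ∑ i, (if i < c then (Pi.single i₀ (1 : F) : Fin n → F) i * ((g⁻¹).val *ᵥ x) i else 0) =
      ∑ l, y l * x l := by
    rw [Finset.sum_eq_single i₀ (fun i _ hi => by rw [Pi.single_eq_of_ne hi, zero_mul, ite_self]) (by simp),
      if_pos hi₀c, Pi.single_eq_same, one_mul, Matrix.mulVec, dotProduct]
    exact Finset.sum_congr rfl fun l _ => by rw [hrow l]
  have rhs : ∑ i, (if i < c then y i * x i else 0) = ∑ l, y l * x l :=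
    Finset.sum_congr rfl fun l _ => by
      split_ifs with hl
      · rfl
      · rw [hxc l (by rw [Fin.lt_def] at hl; omega), mul_zero]
  rw [lhs, rhs]

/-- `V_c ≤ N_c`. [folklore] -/
theorem colGroup_le_tailGroup (c : Fin n) : colGroup F n c ≤ tailGroup F n c.val :=
  fun _ hg => ⟨hg.1, fun j hj i => hg.2 j (fun h => by
    have hj' : j.val < c.val := hj
    rw [h] at hj'; exact lt_irrefl _ hj') i⟩

/-- `GL_c` normalises `V_c`. [folklore] -/
theorem leviBlock_conj_mem_colGroup {c : Fin n} {g a : GL (Fin n) F} (hg : g ∈ leviBlock F n c.val)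
    (ha : a ∈ colGroup F n c) : g⁻¹ * a * g ∈ colGroup F n c := by
  have hgi : g⁻¹ ∈ leviBlock F n c.val := (leviBlock F n c.val).inv_mem hg
  set x : Fin n → F := fun i => if i < c then a.val i c else 0 with hx
  have hax : a = colElem F n c x := by
    rw [eq_colElem_of_mem F n ha]
    apply Units.ext; ext i j
    simp only [coe_colElem, Matrix.add_apply, colMatrix_apply, hx]
    split_ifs with h1 h2
    · rfl
    · exact absurd h1.2 h2
    · rfl
  have hxc : ∀ i : Fin n, c.val ≤ i.val → x i = 0 := fun i hi => by
    rw [hx]; dsimp only; rw [if_neg]; rw [Fin.lt_def]; omega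
  have := leviBlock_conj_colElem hgi x hxc
  rw [inv_inv, ← hax] at this
  rw [this]
  exact colElem_mem F n c _

/-! ### The weight spaces `W_t` and the action of `N_c`, `GL_c` on `W_{c+1}` -/

section Weights

variable (ψ₀ : AddChar F ℂ) {V : Type} [AddCommGroup V] [Module ℂ V] (ρ : Representation ℂ (GL (Fin n) F) V)

/-- **`W_c = W_{c+1} ∩ V_c^{θ_{e_{c-1}}}`**: a vector is a `θ_c`-eigenvector of `N_c = V_c N_{c+1}` iff
it is a `θ_{c+1}`-eigenvector of `N_{c+1}` on which `V_c` acts through `x ↦ ψ₀(x_{c-1})`. [folklore] -/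
theorem weightSpace_tailGroup_eq_inf {c : Fin n} (hc : 1 ≤ c.val) :
    weightSpace ρ (tailGroup F n c.val) (fun u => theta ψ₀ c.val (u : GL (Fin n) F)) =
      weightSpace ρ (tailGroup F n (c.val + 1)) (fun u => theta ψ₀ (c.val + 1) (u : GL (Fin n) F)) ⊓
        weightSpace ρ (colGroup F n c)
          (fun a => colChar ψ₀ c (Pi.single (⟨c.val - 1, by omega⟩ : Fin n) (1 : F)) (a : GL (Fin n) F)) := by
  ext w
  simp only [Submodule.mem_inf, mem_weightSpace]
  constructor
  · intro hw
    refine ⟨fun u => ?_, fun a => ?_⟩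
    · rw [hw ⟨u, tailGroup_mono F n (Nat.le_succ _) u.2⟩]
      simp only
      rw [theta_eq_theta_succ_of_mem_tailGroup ψ₀ u.2]
    · rw [hw ⟨a, colGroup_le_tailGroup c a.2⟩]
      simp only
      rw [theta_of_mem_colGroup ψ₀ hc a.2]
  · rintro ⟨hw1, hw2⟩ g
    set a := colElem F n c (fun i => (g : GL (Fin n) F).val i c) with ha
    have haA : a ∈ colGroup F n c := colElem_mem F n c _
    have hu : a⁻¹ * g ∈ tailGroup F n (c.val + 1) := colElem_inv_mul_mem_tailGroup g.2
    have hg : (g : GL (Fin n) F) = a * (a⁻¹ * g) := by group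
    have h1 := hw1 ⟨a⁻¹ * g, hu⟩
    have h2 := hw2 ⟨a, haA⟩
    simp only at h1 h2
    rw [hg, map_mul, Module.End.mul_apply, h1, map_smul, h2, smul_smul,
      theta_mul ψ₀ c.val (colGroup_le_unitUpper c haA) hu.1,
      theta_of_mem_colGroup ψ₀ hc haA, theta_eq_theta_succ_of_mem_tailGroup ψ₀ hu, mul_comm]

/-- `N_c` preserves `W_{c+1}`. [folklore] -/
theorem apply_mem_weightSpace_tailGroup_succ {c : Fin n} {g : GL (Fin n) F} (hg : g ∈ tailGroup F n c.val)
    {w : V} (hw : w ∈ weightSpace ρ (tailGroup F n (c.val + 1)) (fun u => theta ψ₀ (c.val + 1) (u : GL (Fin n) F))) :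
    ρ g w ∈ weightSpace ρ (tailGroup F n (c.val + 1)) (fun u => theta ψ₀ (c.val + 1) (u : GL (Fin n) F)) := by
  intro u
  have hconj := conj_mem_tailGroup_succ hg u.2
  have h1 := hw ⟨g⁻¹ * u * g, hconj⟩
  simp only at h1 ⊢
  calc ρ u (ρ g w) = ρ g (ρ (g⁻¹ * u * g) w) := by
        rw [← Module.End.mul_apply, ← map_mul, ← Module.End.mul_apply, ← map_mul]
        congr 2; group
    _ = theta ψ₀ (c.val + 1) (u : GL (Fin n) F) • ρ g w := by
        rw [h1, map_smul, theta_conj ψ₀ (c.val + 1) (tailGroup_le_unitUpper _ hg) (tailGroup_le_unitUpper _ u.2)]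

/-- `GL_c` preserves `W_{c+1}`. [folklore] -/
theorem apply_mem_weightSpace_tailGroup_succ_of_leviBlock {c : Fin n} {g : GL (Fin n) F}
    (hg : g ∈ leviBlock F n c.val) {w : V}
    (hw : w ∈ weightSpace ρ (tailGroup F n (c.val + 1)) (fun u => theta ψ₀ (c.val + 1) (u : GL (Fin n) F))) :
    ρ g w ∈ weightSpace ρ (tailGroup F n (c.val + 1)) (fun u => theta ψ₀ (c.val + 1) (u : GL (Fin n) F)) := by
  intro u
  have hgi : g⁻¹ ∈ leviBlock F n c.val := (leviBlock F n c.val).inv_mem hg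
  have hconj := leviBlock_conj_mem_tailGroup hgi u.2
  rw [inv_inv] at hconj
  have h1 := hw ⟨g⁻¹ * u * g, hconj⟩
  simp only at h1 ⊢
  calc ρ u (ρ g w) = ρ g (ρ (g⁻¹ * u * g) w) := by
        rw [← Module.End.mul_apply, ← map_mul, ← Module.End.mul_apply, ← map_mul]
        congr 2; group
    _ = theta ψ₀ (c.val + 1) (u : GL (Fin n) F) • ρ g w := by
        have := theta_leviBlock_conj ψ₀ hgi u.2
        rw [inv_inv] at this
        rw [h1, map_smul, this]

/-- **Weight transport**: if `yᵀ g = e_{c-1}ᵀ` (`g ∈ GL_c`), then `ρ(g)` maps the `θ_{e_{c-1}}`-weight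
space of `V_c` into the `θ_y`-weight space, and `ρ(g⁻¹)` maps back. [folklore] -/
theorem apply_mem_weightSpace_colGroup_of_vecMul_eq_single {c : Fin n} (hc : 1 ≤ c.val)
    {y : Fin n → F} {g : GL (Fin n) F} (hg : g ∈ leviBlock F n c.val)
    (hyg : y ᵥ* g.val = Pi.single (⟨c.val - 1, by omega⟩ : Fin n) (1 : F)) {v : V}
    (hv : v ∈ weightSpace ρ (colGroup F n c)
      (fun a => colChar ψ₀ c (Pi.single (⟨c.val - 1, by omega⟩ : Fin n) (1 : F)) (a : GL (Fin n) F))) :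
    ρ g v ∈ weightSpace ρ (colGroup F n c) (fun a => colChar ψ₀ c y (a : GL (Fin n) F)) := by
  intro a
  have hconj := leviBlock_conj_mem_colGroup hg a.2
  have h1 := hv ⟨g⁻¹ * a * g, hconj⟩
  simp only at h1 ⊢
  calc ρ a (ρ g v) = ρ g (ρ (g⁻¹ * a * g) v) := by
        rw [← Module.End.mul_apply, ← map_mul, ← Module.End.mul_apply, ← map_mul]
        congr 2; group
    _ = colChar ψ₀ c y (a : GL (Fin n) F) • ρ g v := by
        rw [h1, map_smul, colChar_conj_eq_of_vecMul_eq_single ψ₀ hc hg hyg a.2]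

/-- The inverse direction of the weight transport: `ρ(g⁻¹)` maps the `θ_y`-weight space to the
`θ_{e_{c-1}}`-weight space. [folklore] -/
theorem apply_inv_mem_weightSpace_colGroup_of_vecMul_eq_single {c : Fin n} (hc : 1 ≤ c.val)
    {y : Fin n → F} {g : GL (Fin n) F} (hg : g ∈ leviBlock F n c.val)
    (hyg : y ᵥ* g.val = Pi.single (⟨c.val - 1, by omega⟩ : Fin n) (1 : F)) {v : V}
    (hv : v ∈ weightSpace ρ (colGroup F n c) (fun a => colChar ψ₀ c y (a : GL (Fin n) F))) :
    ρ g⁻¹ v ∈ weightSpace ρ (colGroup F n c)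
      (fun a => colChar ψ₀ c (Pi.single (⟨c.val - 1, by omega⟩ : Fin n) (1 : F)) (a : GL (Fin n) F)) := by
  intro a
  have hgi : g⁻¹ ∈ leviBlock F n c.val := (leviBlock F n c.val).inv_mem hg
  have hconj := leviBlock_conj_mem_colGroup hgi a.2
  rw [inv_inv] at hconj
  have h1 := hv ⟨g * a * g⁻¹, hconj⟩
  simp only at h1 ⊢
  have key : colChar ψ₀ c y (g * a * g⁻¹) =
      colChar ψ₀ c (Pi.single (⟨c.val - 1, by omega⟩ : Fin n) (1 : F)) (a : GL (Fin n) F) := by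
    rw [← colChar_conj_eq_of_vecMul_eq_single ψ₀ hc hg hyg hconj]
    congr 1; group
  calc ρ a (ρ g⁻¹ v) = ρ g⁻¹ (ρ (g * a * g⁻¹) v) := by
        rw [← Module.End.mul_apply, ← map_mul, ← Module.End.mul_apply, ← map_mul]
        congr 2; group
    _ = _ := by rw [h1, map_smul, key]

/-- **All non-trivial weights of `V_c` in `W_{c+1}` have the dimension of the weight `θ_{e_{c-1}}`.**
[folklore] -/
theorem finrank_inf_weightSpace_colGroup_eq [FiniteDimensional ℂ V] {c : Fin n} (hc : 1 ≤ c.val)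
    (y : Fin n → F) (hy : ∀ i : Fin n, c.val ≤ i.val → y i = 0) (hy0 : y ≠ 0) :
    finrank ℂ ↥(weightSpace ρ (tailGroup F n (c.val + 1)) (fun u => theta ψ₀ (c.val + 1) (u : GL (Fin n) F)) ⊓
        weightSpace ρ (colGroup F n c) (fun a => colChar ψ₀ c y (a : GL (Fin n) F))) =
      finrank ℂ ↥(weightSpace ρ (tailGroup F n (c.val + 1)) (fun u => theta ψ₀ (c.val + 1) (u : GL (Fin n) F)) ⊓
        weightSpace ρ (colGroup F n c)
          (fun a => colChar ψ₀ c (Pi.single (⟨c.val - 1, by omega⟩ : Fin n) (1 : F)) (a : GL (Fin n) F))) := by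
  obtain ⟨g, hg, hyg⟩ := exists_leviBlock_vecMul_eq_single hc y hy hy0
  set W := weightSpace ρ (tailGroup F n (c.val + 1)) (fun u => theta ψ₀ (c.val + 1) (u : GL (Fin n) F)) with hW
  set Vy := weightSpace ρ (colGroup F n c) (fun a => colChar ψ₀ c y (a : GL (Fin n) F)) with hVy
  set Ve := weightSpace ρ (colGroup F n c)
    (fun a => colChar ψ₀ c (Pi.single (⟨c.val - 1, by omega⟩ : Fin n) (1 : F)) (a : GL (Fin n) F)) with hVe
  have hinj : ∀ x : GL (Fin n) F, Function.Injective (ρ x) := fun x v w h => by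
    have := congrArg (ρ x⁻¹) h
    rwa [← Module.End.mul_apply, ← map_mul, inv_mul_cancel, map_one, Module.End.one_apply,
      ← Module.End.mul_apply, ← map_mul, inv_mul_cancel, map_one, Module.End.one_apply] at this
  -- `ρ g : W ⊓ Ve → W ⊓ Vy` and `ρ g⁻¹ : W ⊓ Vy → W ⊓ Ve`
  let L₁ : ↥(W ⊓ Ve) →ₗ[ℂ] ↥(W ⊓ Vy) :=
    ((ρ g).domRestrict (W ⊓ Ve)).codRestrict (W ⊓ Vy) fun v =>
      ⟨apply_mem_weightSpace_tailGroup_succ_of_leviBlock ψ₀ ρ hg v.2.1,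
        apply_mem_weightSpace_colGroup_of_vecMul_eq_single ψ₀ ρ hc hg hyg v.2.2⟩
  let L₂ : ↥(W ⊓ Vy) →ₗ[ℂ] ↥(W ⊓ Ve) :=
    ((ρ g⁻¹).domRestrict (W ⊓ Vy)).codRestrict (W ⊓ Ve) fun v =>
      ⟨apply_mem_weightSpace_tailGroup_succ_of_leviBlock ψ₀ ρ ((leviBlock F n c.val).inv_mem hg) v.2.1,
        apply_inv_mem_weightSpace_colGroup_of_vecMul_eq_single ψ₀ ρ hc hg hyg v.2.2⟩
  have h₁ : Function.Injective L₁ := fun v w h => by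
    apply Subtype.ext
    apply hinj g
    have := congrArg Subtype.val h
    simpa [L₁] using this
  have h₂ : Function.Injective L₂ := fun v w h => by
    apply Subtype.ext
    apply hinj g⁻¹
    have := congrArg Subtype.val h
    simpa [L₂] using this
  exact le_antisymm (LinearMap.finrank_le_finrank_of_injective h₂) (LinearMap.finrank_le_finrank_of_injective h₁)

end Weights

/-! ### The unipotent radical `U_{(c, n-c)}` and the vanishing of the trivial weight -/

/-- A matrix with identity columns `< c` and identity rows `≥ c` lies in `N_c`. [folklore] -/
theorem mem_tailGroup_of_mem_fixCols_fixRows {c : ℕ} {g : GL (Fin n) F}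
    (h1 : g ∈ fixCols F n {j | j.val < c}) (h2 : g ∈ fixRows F n {i | c ≤ i.val}) : g ∈ tailGroup F n c := by
  refine ⟨⟨fun i j hij => ?_, fun i => ?_⟩, h1⟩
  · by_cases hj : j.val < c
    · rw [h1 j hj i, Matrix.one_apply_ne (ne_of_gt hij)]
    · rw [h2 i (show c ≤ i.val by rw [Fin.lt_def] at hij; omega) j, Matrix.one_apply_ne (ne_of_gt hij)]
  · by_cases hi : i.val < c
    · rw [h1 i hi i, Matrix.one_apply_eq]
    · rw [h2 i (show c ≤ i.val by omega) i, Matrix.one_apply_eq]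

/-- `θ_{c+1}` is trivial on matrices with identity rows `≥ c`. [folklore] -/
theorem theta_succ_eq_one_of_mem_fixRows (ψ₀ : AddChar F ℂ) {c : ℕ} {g : GL (Fin n) F}
    (h2 : g ∈ fixRows F n {i | c ≤ i.val}) : theta ψ₀ (c + 1) g = 1 := by
  rw [theta]
  convert AddChar.map_zero_eq_one ψ₀
  refine Finset.sum_eq_zero fun i _ => ?_
  split_ifs with h
  · unfold superdiag
    split_ifs with h'
    · rw [h2 i (show c ≤ i.val by omega), Matrix.one_apply_ne]
      exact fun e => by have := congrArg Fin.val e; simp at this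
    · rfl
  · rfl

/-- **The block unipotent radical in coordinates**: the image in `GL_n(F)` of `ker(levi)` (matrices
`(1 B; 0 1)`) consists of matrices with identity columns `< k` and identity rows `≥ k`. [folklore] -/
theorem blockEquiv_mem_fixCols_fixRows {k m : ℕ} (h : k + m = n)
    {g : GLBlock.parabolic F (Fin k) (Fin m)} (hg : g ∈ (GLBlock.levi F (Fin k) (Fin m)).ker) :
    blockEquiv F h (g : GL (Fin k ⊕ Fin m) F) ∈ fixCols F n {j | j.val < k} ∧
      blockEquiv F h (g : GL (Fin k ⊕ Fin m) F) ∈ fixRows F n {i | k ≤ i.val} := by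
  set e : Fin k ⊕ Fin m ≃ Fin n := finSumFinEquiv.trans (finCongr h) with he
  obtain ⟨B, hB⟩ : ∃ B : Matrix (Fin k) (Fin m) F, (g : GL (Fin k ⊕ Fin m) F).val = Matrix.fromBlocks 1 B 0 1 :=
    ⟨_, GLBlock.coe_eq_fromBlocks_of_mem_ker hg⟩
  have hval : ∀ i j, (blockEquiv F h (g : GL (Fin k ⊕ Fin m) F)).val i j =
      Matrix.fromBlocks 1 B 0 1 (e.symm i) (e.symm j) := fun i j => by
    show (GLBlock.reindex F e (g : GL (Fin k ⊕ Fin m) F) : GL (Fin n) F).val i j = _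
    rw [GLBlock.coe_reindex, Matrix.reindex_apply, Matrix.submatrix_apply, hB]
  have he1 : ∀ a : Fin k, (e (Sum.inl a)).val = a.val := fun a => by simp [he]
  have he2 : ∀ b : Fin m, (e (Sum.inr b)).val = k + b.val := fun b => by simp [he]
  have hval_inl : ∀ i, ∀ a, e.symm i = Sum.inl a → i.val = a.val := fun i a hi => by
    rw [← he1 a, ← hi, Equiv.apply_symm_apply]
  have hval_inr : ∀ i, ∀ b, e.symm i = Sum.inr b → i.val = k + b.val := fun i b hi => by
    rw [← he2 b, ← hi, Equiv.apply_symm_apply]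
  constructor
  · intro j hj i
    simp only [Set.mem_setOf_eq] at hj
    rw [hval]
    rcases hj' : e.symm j with a | b
    · rcases hi' : e.symm i with a' | b'
      · rw [Matrix.fromBlocks_apply₁₁, Matrix.one_apply, Matrix.one_apply]
        have h1 := hval_inl j a hj'; have h2 := hval_inl i a' hi'
        by_cases hij : i = j
        · subst hij; rw [hi'] at hj'; cases hj'; simp
        · rw [if_neg, if_neg hij]
          intro e'; apply hij; exact Fin.ext (by rw [h1, h2, e'])
      · rw [Matrix.fromBlocks_apply₂₁, Matrix.zero_apply, Matrix.one_apply_ne]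
        intro e'; subst e'
        have h1 := hval_inl i a hj'; have h2 := hval_inr i b' hi'
        omega
    · have := hval_inr j b hj'; omega
  · intro i hi j
    simp only [Set.mem_setOf_eq] at hi
    rw [hval]
    rcases hi' : e.symm i with a | b
    · have := hval_inl i a hi'; omega
    · rcases hj' : e.symm j with a' | b'
      · rw [Matrix.fromBlocks_apply₂₁, Matrix.zero_apply, Matrix.one_apply_ne]
        intro e'; subst e'
        have h1 := hval_inr i b hi'; have h2 := hval_inl i a' hj'
        omega
      · rw [Matrix.fromBlocks_apply₂₂, Matrix.one_apply, Matrix.one_apply]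
        have h1 := hval_inr i b hi'; have h2 := hval_inr j b' hj'
        by_cases hij : i = j
        · subst hij; rw [hi'] at hj'; cases hj'; simp
        · rw [if_neg, if_neg hij]
          intro e'; apply hij; exact Fin.ext (by rw [h1, h2, e'])

section ZeroWeight

variable [Fintype F] [DecidableEq F] (ψ₀ : AddChar F ℂ) {V : Type} [AddCommGroup V] [Module ℂ V]
  [FiniteDimensional ℂ V] (ρ : Representation ℂ (GL (Fin n) F) V)

/-- **Cuspidality kills the trivial weight of `V_c` in `W_{c+1}`**: such a vector is fixed by the
unipotent radical `U_{(c,n-c)} = V_c · (N_{c+1} ∩ U_{(c,n-c)})`, whose fixed space is `0` since the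
character sum over it vanishes. [folklore] -/
theorem inf_weightSpace_colGroup_zero_eq_bot {c : Fin n} (hc : 1 ≤ c.val)
    (hcusp : ∀ (k m : ℕ) (h : k + m = n), 1 ≤ k → 1 ≤ m →
      ∑ u : (GLBlock.levi F (Fin k) (Fin m)).ker,
        ρ.character (blockEquiv F h ((u : GLBlock.parabolic F (Fin k) (Fin m)) : GL (Fin k ⊕ Fin m) F)) = 0) :
    weightSpace ρ (tailGroup F n (c.val + 1)) (fun u => theta ψ₀ (c.val + 1) (u : GL (Fin n) F)) ⊓
        weightSpace ρ (colGroup F n c) (fun a => colChar ψ₀ c 0 (a : GL (Fin n) F)) = ⊥ := by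
  have h : c.val + (n - c.val) = n := Nat.add_sub_cancel' c.2.le
  set K := (GLBlock.levi F (Fin c.val) (Fin (n - c.val))).ker with hK
  let φ : K →* GL (Fin n) F :=
    (blockEquiv F h).toMonoidHom.comp
      ((GLBlock.parabolic F (Fin c.val) (Fin (n - c.val))).subtype.comp K.subtype)
  let ρK : Representation ℂ K V := ρ.comp φ
  -- (ii) `V^{U} = 0`
  have hinv : ρK.invariants = ⊥ := by
    haveI : Invertible (Fintype.card K : ℂ) := invertibleOfNonzero (Nat.cast_ne_zero.mpr Fintype.card_ne_zero)
    have htr : LinearMap.trace ℂ V ρK.averageMap = (finrank ℂ ρK.invariants : ℂ) := ρK.isProj_averageMap.trace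
    have hsum : ∑ u : K, LinearMap.trace ℂ V (ρK u) = 0 := hcusp c.val (n - c.val) h hc (by omega)
    have htr0 : LinearMap.trace ℂ V ρK.averageMap = 0 := by
      simp only [Representation.averageMap, GroupAlgebra.average, map_smul, map_sum,
        Representation.asAlgebraHom_of, hsum, smul_zero]
    have h0 : finrank ℂ ρK.invariants = 0 := by exact_mod_cast htr.symm.trans htr0
    exact Submodule.finrank_eq_zero.mp h0
  rw [eq_bot_iff]
  rintro w ⟨hw1, hw2⟩
  -- (i) `w` is fixed by `U_{(c,n-c)}`
  have hwinv : w ∈ ρK.invariants := by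
    rw [Representation.mem_invariants]
    intro u
    show ρ (φ u) w = w
    set p : GL (Fin n) F := φ u with hp
    obtain ⟨hp1, hp2⟩ : p ∈ fixCols F n {j | j.val < c.val} ∧ p ∈ fixRows F n {i | c.val ≤ i.val} :=
      blockEquiv_mem_fixCols_fixRows h u.2
    have hpT : p ∈ tailGroup F n c.val := mem_tailGroup_of_mem_fixCols_fixRows hp1 hp2
    set a := colElem F n c (fun i => p.val i c) with ha
    have haA : a ∈ colGroup F n c := colElem_mem F n c _
    have hu' : a⁻¹ * p ∈ tailGroup F n (c.val + 1) := colElem_inv_mul_mem_tailGroup hpT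
    have hθ : theta ψ₀ (c.val + 1) (a⁻¹ * p) = 1 := by
      rw [theta_mul ψ₀ _ ((unitUpper F n).inv_mem (colGroup_le_unitUpper c haA)) hpT.1,
        theta_succ_of_mem_colGroup ψ₀ ((colGroup F n c).inv_mem haA), theta_succ_eq_one_of_mem_fixRows ψ₀ hp2,
        one_mul]
    have h1 := hw1 ⟨a⁻¹ * p, hu'⟩
    have h2 := hw2 ⟨a, haA⟩
    simp only at h1 h2
    rw [hθ, one_smul] at h1
    rw [colChar_zero, one_smul] at h2
    calc ρ p w = ρ a (ρ (a⁻¹ * p) w) := by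
          rw [← Module.End.mul_apply, ← map_mul, mul_inv_cancel_left]
      _ = w := by rw [h1, h2]
  rw [hinv] at hwinv
  exact hwinv

end ZeroWeight

/-! ### The characters `θ_y` of `V_c ≅ F^c`: irreducibility, orthogonality, completeness -/

section Characters

variable [Fintype F] [DecidableEq F] (ψ₀ : AddChar F ℂ)

omit [Fintype F] [DecidableEq F] in
/-- A multiplicative character `G → ℂ` (with `θ(1) = 1`) is an irreducible character: it is the
character of a one-dimensional representation. [folklore] -/
theorem isIrrChar_of_mul {G : Type} [Group G] (θ : G → ℂ) (h1 : θ 1 = 1)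
    (hmul : ∀ a b, θ (a * b) = θ a * θ b) : IsIrrChar G θ := by
  let θ' : G →* ℂ := { toFun := θ, map_one' := h1, map_mul' := hmul }
  let ρ₁ : Representation ℂ G ℂ := (DistribMulAction.toModuleEnd ℂ ℂ).comp θ'
  refine ⟨ℂ, _, _, inferInstance, ρ₁, isIrreducible_of_finrank_eq_one ρ₁ (finrank_self ℂ), funext fun g => ?_⟩
  show LinearMap.trace ℂ ℂ (DistribMulAction.toModuleEnd ℂ ℂ (θ g)) = θ g
  have : DistribMulAction.toModuleEnd ℂ ℂ (θ g) = θ g • LinearMap.id := by ext; simp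
  rw [this, map_smul, LinearMap.trace_id, finrank_self, Nat.cast_one, smul_eq_mul, mul_one]

omit [Fintype F] [DecidableEq F] in
/-- `θ_y` is an irreducible character of `V_c`. [folklore] -/
theorem isIrrChar_colChar (c : Fin n) (y : Fin n → F) :
    IsIrrChar (colGroup F n c) (fun a => colChar ψ₀ c y (a : GL (Fin n) F)) :=
  isIrrChar_of_mul _ (by simp [colChar_one]) fun a b => colChar_mul ψ₀ c y a.2 b.2

omit [Fintype F] [DecidableEq F] in
/-- `colElem c x` only depends on `x_i`, `i < c`. [folklore] -/
theorem colElem_congr (c : Fin n) {x x' : Fin n → F} (h : ∀ i, i < c → x i = x' i) :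
    colElem F n c x = colElem F n c x' := by
  apply Units.ext; ext i j
  simp only [coe_colElem, Matrix.add_apply, colMatrix_apply]
  split_ifs with h1
  · rw [h i h1.2]
  · rfl

omit [DecidableEq F] in
/-- **`|V_c| = q^c`**: `V_c ≅ F^c` via the column entries. [folklore] -/
theorem card_colGroup (c : Fin n) [Fintype (colGroup F n c)] :
    Fintype.card (colGroup F n c) = Fintype.card F ^ c.val := by
  classical
  let ext : (Fin c.val → F) → Fin n → F := fun y i => if h : i.val < c.val then y ⟨i.val, h⟩ else 0
  let f : (Fin c.val → F) → colGroup F n c := fun y => ⟨colElem F n c (ext y), colElem_mem F n c _⟩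
  have hf : Function.Bijective f := by
    constructor
    · intro y y' hyy
      funext i
      have hic : Fin.castLE c.2.le i < c := by rw [Fin.lt_def]; simp
      have h1 := congrArg (fun a : colGroup F n c => (a : GL (Fin n) F).val (Fin.castLE c.2.le i) c) hyy
      simpa [f, ext, colElem_apply, hic, Matrix.one_apply_ne (ne_of_lt hic)] using h1
    · intro a
      refine ⟨fun i => (a : GL (Fin n) F).val (Fin.castLE c.2.le i) c, Subtype.ext ?_⟩
      show colElem F n c (ext fun i => (a : GL (Fin n) F).val (Fin.castLE c.2.le i) c) = (a : GL (Fin n) F)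
      conv_rhs => rw [eq_colElem_of_mem F n a.2]
      refine colElem_congr c fun i hi => ?_
      simp only [ext]
      rw [dif_pos (Fin.lt_def.mp hi)]
      rfl
  rw [← Fintype.card_of_bijective hf, Fintype.card_fun, Fintype.card_fin]

/-- **Orthogonality/completeness of the `θ_y`**: `∑_{y ∈ F^c} θ_y(a) = q^c [a = 1]` for `a ∈ V_c`
(`ψ₀` non-trivial). [folklore] -/
theorem sum_colChar_eq (hψ₀ : ψ₀ ≠ 1) (c : Fin n) {a : GL (Fin n) F} (ha : a ∈ colGroup F n c) :
    ∑ y : Fin c.val → F, colChar ψ₀ c (fun i => if h : i.val < c.val then y ⟨i.val, h⟩ else 0) a =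
      if a = 1 then (Fintype.card F : ℂ) ^ c.val else 0 := by
  split_ifs with h1
  · subst h1
    simp only [colChar_one, Finset.sum_const, Finset.card_univ, Fintype.card_fun, Fintype.card_fin,
      nsmul_eq_mul, mul_one, Nat.cast_pow]
  · -- `a ≠ 1`: some entry `a_{ic} ≠ 0` with `i < c`, and `y ↦ θ_y(a)` is a non-trivial character of `F^c`
    obtain ⟨i, hic, hi⟩ : ∃ i : Fin n, i < c ∧ a.val i c ≠ 0 := by
      by_contra hcon
      push Not at hcon
      apply h1
      rw [eq_colElem_of_mem F n ha, ← colElem_zero F n c]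
      exact colElem_congr c fun i hi => hcon i hi
    let Ψ : AddChar (Fin c.val → F) ℂ :=
      { toFun := fun y => colChar ψ₀ c (fun i => if h : i.val < c.val then y ⟨i.val, h⟩ else 0) a
        map_zero_eq_one' := by
          have : (fun i : Fin n => if h : i.val < c.val then (0 : Fin c.val → F) ⟨i.val, h⟩ else 0) = 0 := by
            funext i; simp
          simp only [this, colChar_zero]
        map_add_eq_mul' := fun y y' => by
          simp only [colChar, ← AddChar.map_add_eq_mul, ← Finset.sum_add_distrib]
          congr 1
          refine Finset.sum_congr rfl fun i _ => ?_
          split_ifs with h2 h3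
          · simp only [Pi.add_apply]; ring
          · exfalso; exact h3 (Fin.lt_def.mp h2)
          · simp }
    have hΨ : Ψ ≠ 1 := by
      obtain ⟨s, hs⟩ := AddChar.ne_one_iff.mp hψ₀
      rw [AddChar.ne_one_iff]
      refine ⟨Pi.single ⟨i.val, Fin.lt_def.mp hic⟩ (s / a.val i c), ?_⟩
      show colChar ψ₀ c _ a ≠ 1
      rw [colChar, Finset.sum_eq_single i]
      · rw [if_pos hic, dif_pos (Fin.lt_def.mp hic)]
        simp only [Pi.single_eq_same]
        rw [div_mul_cancel₀ _ hi]
        exact hs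
      · intro j _ hj
        split_ifs with h2 h3
        · rw [Pi.single_eq_of_ne (fun e => hj (Fin.ext (by have := congrArg Fin.val e; simpa using this))),
            zero_mul]
        · exfalso; exact h3 (Fin.lt_def.mp h2)
        · rfl
      · simp
    exact AddChar.sum_eq_zero_of_ne_one hΨ

variable {V : Type} [AddCommGroup V] [Module ℂ V] [FiniteDimensional ℂ V] (ρ : Representation ℂ (GL (Fin n) F) V)

omit [FiniteDimensional ℂ V] in
/-- **`∑_y e_{θ_y} = id`** on `V`: the weight projectors of `V_c` for the `q^c` characters `θ_y`
sum to the identity. [folklore] -/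
theorem sum_weightProj_colChar_apply (hψ₀ : ψ₀ ≠ 1) (c : Fin n) [Fintype (colGroup F n c)] (v : V) :
    ∑ y : Fin c.val → F, weightProj ρ (colGroup F n c)
      (fun a => colChar ψ₀ c (fun i => if h : i.val < c.val then y ⟨i.val, h⟩ else 0) (a : GL (Fin n) F)) v = v := by
  simp only [weightProj_apply]
  rw [← Finset.smul_sum, Finset.sum_comm]
  have key : ∀ a : colGroup F n c,
      ∑ y : Fin c.val → F, colChar ψ₀ c (fun i => if h : i.val < c.val then y ⟨i.val, h⟩ else 0)
        ((a⁻¹ : colGroup F n c) : GL (Fin n) F) • ρ a v =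
      (if a = 1 then (Fintype.card F : ℂ) ^ c.val else 0) • ρ a v := fun a => by
    rw [← Finset.sum_smul, sum_colChar_eq ψ₀ hψ₀ c (a⁻¹).2]
    congr 1
    simp only [Subgroup.coe_inv, inv_eq_one, OneMemClass.coe_eq_one]
  simp only [key, ite_smul, zero_smul, Finset.sum_ite_eq', Finset.mem_univ, if_true, OneMemClass.coe_one,
    map_one, Module.End.one_apply, smul_smul]
  rw [card_colGroup, Nat.cast_pow, inv_mul_cancel₀ (pow_ne_zero _ (Nat.cast_ne_zero.mpr Fintype.card_ne_zero)),
    one_smul]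

omit [Fintype F] in
/-- Distinct `y` give distinct characters `θ_y` (`ψ₀` non-trivial). [folklore] -/
theorem colChar_ext_injective (hψ₀ : ψ₀ ≠ 1) (c : Fin n) {y y' : Fin c.val → F}
    (h : (fun a : colGroup F n c =>
        colChar ψ₀ c (fun i => if h : i.val < c.val then y ⟨i.val, h⟩ else 0) (a : GL (Fin n) F)) =
      fun a : colGroup F n c =>
        colChar ψ₀ c (fun i => if h : i.val < c.val then y' ⟨i.val, h⟩ else 0) (a : GL (Fin n) F)) :
    y = y' := by
  by_contra hne
  obtain ⟨i, hi⟩ : ∃ i, y i ≠ y' i := by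
    by_contra hcon; push Not at hcon; exact hne (funext hcon)
  obtain ⟨s, hs⟩ := AddChar.ne_one_iff.mp hψ₀
  set i' : Fin n := Fin.castLE c.2.le i with hi'
  have hic : i' < c := by rw [Fin.lt_def]; simp [hi']
  -- evaluate both characters at `colElem c (t e_{i'})`, `t = s / (y i - y' i)`
  set t : F := s / (y i - y' i) with ht
  have key := congrFun h ⟨colElem F n c (Pi.single i' t), colElem_mem F n c _⟩
  simp only [colChar_colElem] at key
  have hsum : ∀ z : Fin c.val → F,
      ∑ j : Fin n, (if j < c then (if h : j.val < c.val then z ⟨j.val, h⟩ else 0) * (Pi.single i' t : Fin n → F) j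
        else 0) = z i * t := fun z => by
    rw [Finset.sum_eq_single i']
    · rw [if_pos hic, dif_pos (Fin.lt_def.mp hic), Pi.single_eq_same]
      congr 2
    · intro j _ hj
      split_ifs
      · rw [Pi.single_eq_of_ne hj, mul_zero]
      · rw [zero_mul]
      · rfl
    · simp
  rw [hsum y, hsum y'] at key
  -- `ψ₀ (y i t) = ψ₀ (y' i t)` forces `ψ₀ ((y i - y' i) t) = 1`, i.e. `ψ₀ s = 1`
  have hsub : y i - y' i ≠ 0 := sub_ne_zero.mpr hi
  have hyt : y i * t = y' i * t + s := by
    rw [ht]; field_simp; ring_nf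
  rw [hyt, AddChar.map_add_eq_mul] at key
  apply hs
  have hne0 : ψ₀ (y' i * t) ≠ 0 := fun h0 => by
    have := AddChar.map_add_eq_mul ψ₀ (y' i * t) (-(y' i * t))
    rw [add_neg_cancel, AddChar.map_zero_eq_one, h0, zero_mul] at this
    exact one_ne_zero this
  exact mul_left_cancel₀ hne0 (key.trans (mul_one _).symm)

end Characters

/-! ### The dimension count -/

section Count

variable [Fintype F] [DecidableEq F] (ψ₀ : AddChar F ℂ) {V : Type} [AddCommGroup V] [Module ℂ V]
  [FiniteDimensional ℂ V] (ρ : Representation ℂ (GL (Fin n) F) V)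

/-- **`dim W_{c+1} = ∑_{y ∈ F^c} dim (W_{c+1} ∩ V_c^{θ_y})`** (weight decomposition of `W_{c+1}` under
the abelian group `V_c`, counted with the traces of the weight projectors). [folklore] -/
theorem finrank_weightSpace_tailGroup_succ_eq_sum (hψ₀ : ψ₀ ≠ 1) (c : Fin n) [Fintype (colGroup F n c)] :
    finrank ℂ ↥(weightSpace ρ (tailGroup F n (c.val + 1)) (fun u => theta ψ₀ (c.val + 1) (u : GL (Fin n) F))) =
      ∑ y : Fin c.val → F, finrank ℂ
        ↥(weightSpace ρ (tailGroup F n (c.val + 1)) (fun u => theta ψ₀ (c.val + 1) (u : GL (Fin n) F)) ⊓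
          weightSpace ρ (colGroup F n c)
            (fun a => colChar ψ₀ c (fun i => if h : i.val < c.val then y ⟨i.val, h⟩ else 0) (a : GL (Fin n) F))) := by
  set A := colGroup F n c with hA
  set W := weightSpace ρ (tailGroup F n (c.val + 1)) (fun u => theta ψ₀ (c.val + 1) (u : GL (Fin n) F)) with hW
  let χ : (Fin c.val → F) → A → ℂ := fun y a =>
    colChar ψ₀ c (fun i => if h : i.val < c.val then y ⟨i.val, h⟩ else 0) (a : GL (Fin n) F)
  have hχ : ∀ y, IsIrrChar A (χ y) := fun y => isIrrChar_colChar ψ₀ c _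
  let E : (Fin c.val → F) → V →ₗ[ℂ] V := fun y => weightProj ρ A (χ y)
  have hEW : ∀ y, ∀ w ∈ W, E y w ∈ W := fun y w hw => by
    simp only [E]
    rw [weightProj_apply]
    refine Submodule.smul_mem _ _ (Submodule.sum_mem _ fun a _ => Submodule.smul_mem _ _ ?_)
    exact apply_mem_weightSpace_tailGroup_succ ψ₀ ρ (colGroup_le_tailGroup c a.2) hw
  let E' : (Fin c.val → F) → W →ₗ[ℂ] W := fun y => (E y).restrict (hEW y)
  have hsum : ∑ y, E' y = LinearMap.id := by
    apply LinearMap.ext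
    intro w
    apply Subtype.ext
    rw [LinearMap.sum_apply, Submodule.coe_sum, LinearMap.id_apply]
    simp only [E', LinearMap.coe_restrict_apply, E, χ]
    exact sum_weightProj_colChar_apply ψ₀ ρ hψ₀ c w
  have hproj : ∀ y, LinearMap.IsProj ((W ⊓ weightSpace ρ A (χ y)).comap W.subtype) (E' y) := fun y =>
    { map_mem := fun w => by
        rw [Submodule.mem_comap, Submodule.subtype_apply]
        exact ⟨hEW y w w.2, weightProj_mem ρ A (hχ y) w⟩
      map_id := fun w hw => by
        rw [Submodule.mem_comap, Submodule.subtype_apply] at hw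
        apply Subtype.ext
        simp only [E', LinearMap.coe_restrict_apply, E]
        rw [weightProj_apply_of_mem ρ A (hχ y) (hχ y) hw.2, if_pos rfl] }
  have htr : (finrank ℂ W : ℂ) = ∑ y, (finrank ℂ ↥((W ⊓ weightSpace ρ A (χ y)).comap W.subtype) : ℂ) := by
    rw [← LinearMap.trace_id, ← hsum, map_sum]
    exact Finset.sum_congr rfl fun y _ => (hproj y).trace
  have hcomap : ∀ y, finrank ℂ ↥((W ⊓ weightSpace ρ A (χ y)).comap W.subtype) =
      finrank ℂ ↥(W ⊓ weightSpace ρ A (χ y)) := fun y =>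
    (Submodule.comapSubtypeEquivOfLe (inf_le_left : W ⊓ weightSpace ρ A (χ y) ≤ W)).finrank_eq
  simp only [hcomap] at htr
  exact_mod_cast htr

/-- **Kirillov's recursion** `dim W_{c+1} = (q^c - 1) dim W_c` for a cuspidal representation
(`1 ≤ c ≤ n-1`). [folklore] -/
theorem finrank_weightSpace_tailGroup_succ (hψ₀ : ψ₀ ≠ 1) {c : Fin n} (hc : 1 ≤ c.val)
    (hcusp : ∀ (k m : ℕ) (h : k + m = n), 1 ≤ k → 1 ≤ m →
      ∑ u : (GLBlock.levi F (Fin k) (Fin m)).ker,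
        ρ.character (blockEquiv F h ((u : GLBlock.parabolic F (Fin k) (Fin m)) : GL (Fin k ⊕ Fin m) F)) = 0) :
    finrank ℂ ↥(weightSpace ρ (tailGroup F n (c.val + 1)) (fun u => theta ψ₀ (c.val + 1) (u : GL (Fin n) F))) =
      (Fintype.card F ^ c.val - 1) *
        finrank ℂ ↥(weightSpace ρ (tailGroup F n c.val) (fun u => theta ψ₀ c.val (u : GL (Fin n) F))) := by
  classical
  haveI : Fintype (colGroup F n c) := Fintype.ofFinite _
  rw [finrank_weightSpace_tailGroup_succ_eq_sum ψ₀ ρ hψ₀ c, ← Finset.add_sum_erase _ _ (Finset.mem_univ (0 : Fin c.val → F))]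
  -- the trivial weight vanishes
  have h0 : (fun i : Fin n => if h : i.val < c.val then (0 : Fin c.val → F) ⟨i.val, h⟩ else 0) = 0 := by
    funext i; simp
  rw [h0, inf_weightSpace_colGroup_zero_eq_bot ψ₀ ρ hc hcusp, finrank_bot, zero_add]
  -- the other weights all have dimension `dim W_c`
  have hconst : ∀ y ∈ (Finset.univ : Finset (Fin c.val → F)).erase 0,
      finrank ℂ ↥(weightSpace ρ (tailGroup F n (c.val + 1)) (fun u => theta ψ₀ (c.val + 1) (u : GL (Fin n) F)) ⊓
        weightSpace ρ (colGroup F n c)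
          (fun a => colChar ψ₀ c (fun i => if h : i.val < c.val then y ⟨i.val, h⟩ else 0) (a : GL (Fin n) F))) =
      finrank ℂ ↥(weightSpace ρ (tailGroup F n c.val) (fun u => theta ψ₀ c.val (u : GL (Fin n) F))) := by
    intro y hy
    have hy0 : y ≠ 0 := Finset.ne_of_mem_erase hy
    rw [weightSpace_tailGroup_eq_inf ψ₀ ρ hc]
    refine finrank_inf_weightSpace_colGroup_eq ψ₀ ρ hc _ (fun i hi => ?_) ?_
    · exact dif_neg (by omega)
    · intro hzero
      apply hy0
      funext i
      have := congrFun hzero (Fin.castLE c.2.le i)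
      simpa using this
  rw [Finset.sum_congr rfl hconst, Finset.sum_const, Finset.card_erase_of_mem (Finset.mem_univ _),
    Finset.card_univ, Fintype.card_fun, Fintype.card_fin, smul_eq_mul]

omit [Fintype F] [DecidableEq F] [FiniteDimensional ℂ V] in
/-- `W_n = V`: the group `N_n` is trivial. [folklore] -/
theorem weightSpace_tailGroup_self_eq_top :
    weightSpace ρ (tailGroup F n n) (fun u => theta ψ₀ n (u : GL (Fin n) F)) = ⊤ := by
  rw [eq_top_iff]
  intro w _ u
  have hu : (u : GL (Fin n) F) = 1 := (mem_tailGroup_of_le F n le_rfl).mp u.2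
  simp only [hu, map_one, Module.End.one_apply, theta_one, one_smul]

/-- **Kirillov's dimension formula** (S. I. Gelfand 1970; Bernstein–Zelevinsky): for a cuspidal
representation `ρ` of `GL_n(𝔽_q)` (all the character sums over the unipotent radicals
`U_{(k,n-k)}`, `1 ≤ k ≤ n-1`, vanish), `dim V = (q-1)(q²-1)⋯(q^{n-1}-1) · dim W_1`, where `W_1` is the
space of Whittaker vectors `{w | ρ(u) w = ψ(u) w, u ∈ U_n}`. [folklore] -/
theorem finrank_eq_prod_mul_finrank_whittaker (hψ₀ : ψ₀ ≠ 1) (hn : 1 ≤ n)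
    (hcusp : ∀ (k m : ℕ) (h : k + m = n), 1 ≤ k → 1 ≤ m →
      ∑ u : (GLBlock.levi F (Fin k) (Fin m)).ker,
        ρ.character (blockEquiv F h ((u : GLBlock.parabolic F (Fin k) (Fin m)) : GL (Fin k ⊕ Fin m) F)) = 0) :
    finrank ℂ V = (∏ i ∈ Finset.range (n - 1), (Fintype.card F ^ (i + 1) - 1)) *
      finrank ℂ ↥(weightSpace ρ (tailGroup F n 1) (fun u => theta ψ₀ 1 (u : GL (Fin n) F))) := by
  have key : ∀ t, 1 ≤ t → t ≤ n →
      finrank ℂ ↥(weightSpace ρ (tailGroup F n t) (fun u => theta ψ₀ t (u : GL (Fin n) F))) =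
        (∏ i ∈ Finset.range (t - 1), (Fintype.card F ^ (i + 1) - 1)) *
          finrank ℂ ↥(weightSpace ρ (tailGroup F n 1) (fun u => theta ψ₀ 1 (u : GL (Fin n) F))) := by
    intro t ht
    induction t, ht using Nat.le_induction with
    | base => intro _; simp
    | succ t ht ih =>
      intro htn
      have hc : 1 ≤ (⟨t, htn⟩ : Fin n).val := ht
      rw [show t + 1 = (⟨t, htn⟩ : Fin n).val + 1 from rfl, finrank_weightSpace_tailGroup_succ ψ₀ ρ hψ₀ hc hcusp,
        ih (by omega)]
      show (Fintype.card F ^ t - 1) * ((∏ i ∈ Finset.range (t - 1), (Fintype.card F ^ (i + 1) - 1)) * _) =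
        (∏ i ∈ Finset.range (t + 1 - 1), (Fintype.card F ^ (i + 1) - 1)) * _
      rw [show t + 1 - 1 = (t - 1) + 1 by omega, Finset.prod_range_succ, Nat.sub_add_cancel ht]
      ring
  rw [← key n hn le_rfl, ← finrank_top ℂ V, ← weightSpace_tailGroup_self_eq_top ψ₀ ρ]

end Count

end Literature.RepresentationTheory.FiniteGroups.GLn

end
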